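import Mathlib.Data.Matrix.ColumnRowPartitioned
import Mathlib.LinearAlgebra.Matrix.NonsingularInverse
import Summits.Langlands.Langlands.Theorems.PhantomRMYoshidaPhantomRMTransportEigenFrobenius

/-!
# Route `PhantomRMYoshida`, support item `PhantomRMTransport` (stmt-Langlands-13641): the block
# frame `(e₀, e₁, F e₀, F e₁)`

Helper for the transport lemma `Summit.Langlands.Langlands.Theses.PhantomRMYoshida.PhantomRMTransport`.
With `R : Γ → M₄(k)` and `Φ` fixed by the Frobenius `F`, `Φ² = aΦ + b` with distinct roots
`λ, λ' = λ^p`, a basis `e₀, e₁` of `ker(Φ - λ)` and the matrices `S g` of `R g` on it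
(`R g e_j = ∑ S g i j • e i`): the matrix `G` with columns `e₀, e₁, F e₀, F e₁` is invertible
(`F e_j ∈ ker(Φ - λ')`, and `k⁴ = ker(Φ-λ) ⊕ ker(Φ-λ')`) and conjugates `R g` to the block diagonal
matrix `S g ⊕ F(S g)` and `Φ` to `λ ⊕ λ ⊕ λ' ⊕ λ'` (`exists_block_frame`).  The second block is the
Frobenius twist because `R g (F e_j) = F (R g e_j) = ∑ (S g i j)^p • F e i`.
-/

set_option linter.dupNamespace false
set_option autoImplicit false

namespace Summit.Langlands.Langlands.Theorems.PhantomRMTransport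

open Matrix Module

universe u v

variable {p : ℕ} [Fact p.Prime] {k : Type u} [Field k] [CharP k p] [PerfectRing k p]
  {Γ : Type v} [Monoid Γ]

/-- **The block frame.** See the module docstring. [folklore] -/
theorem exists_block_frame {R : Γ →* Matrix (Fin 4) (Fin 4) k} {Φ : Matrix (Fin 4) (Fin 4) k}
    {a b lam lam' : k} (hΦ : Φ * Φ = a • Φ + b • 1) (h : lam * lam = a * lam + b)
    (h' : lam' * lam' = a * lam' + b) (hne : lam ≠ lam') (hΦf : Φ.map (frobenius k p) = Φ)
    (hlam : lam ^ p = lam') (hRf : ∀ g, (R g).map (frobenius k p) = R g)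
    {e : Fin 2 → Fin 4 → k} (he : ∀ j, e j ∈ End.eigenspace (Matrix.toLin' Φ) lam)
    (hli : LinearIndependent k e)
    {S : Γ → Matrix (Fin 2) (Fin 2) k} (hS : ∀ g j, R g *ᵥ e j = ∑ i, S g i j • e i) :
    ∃ G : Matrix (Fin 4) (Fin 4) k, IsUnit G ∧
      (∀ g, R g * G = G * Matrix.reindex finSumFinEquiv finSumFinEquiv
          (Matrix.fromBlocks (S g) 0 0 ((S g).map (frobenius k p)))) ∧
      Φ * G = G * Matrix.reindex finSumFinEquiv finSumFinEquiv
          (Matrix.fromBlocks (lam • (1 : Matrix (Fin 2) (Fin 2) k)) 0 0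
            (lam' • (1 : Matrix (Fin 2) (Fin 2) k))) := by
  -- the matrices with columns `e j` and `F e j`
  let E : Matrix (Fin 4) (Fin 2) k := Matrix.of fun i j => e j i
  let Ef : Matrix (Fin 4) (Fin 2) k := E.map (frobenius k p)
  let G₀ : Matrix (Fin 4) (Fin 2 ⊕ Fin 2) k := Matrix.fromCols E Ef
  let e4 : Fin 2 ⊕ Fin 2 ≃ Fin 4 := finSumFinEquiv
  let G : Matrix (Fin 4) (Fin 4) k := G₀.submatrix id e4.symm
  -- (i) `R g * E = E * S g`
  have hRE : ∀ g, R g * E = E * S g := by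
    intro g
    ext a j
    have h1 := congrFun (hS g j) a
    simp only [Matrix.mulVec, dotProduct, Finset.sum_apply, Pi.smul_apply, smul_eq_mul] at h1
    simp only [Matrix.mul_apply, E, Matrix.of_apply]
    rw [h1]
    exact Finset.sum_congr rfl fun i _ => mul_comm _ _
  -- (ii) `R g * Ef = Ef * F(S g)`
  have hREf : ∀ g, R g * Ef = Ef * (S g).map (frobenius k p) := by
    intro g
    have h1 := congrArg (fun M : Matrix (Fin 4) (Fin 2) k => M.map (frobenius k p)) (hRE g)
    simp only [Matrix.map_mul, hRf] at h1
    exact h1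
  -- (iii) `Φ * E = λ E`, `Φ * Ef = λ' Ef`
  have hΦE : Φ * E = E * (lam • (1 : Matrix (Fin 2) (Fin 2) k)) := by
    rw [Matrix.mul_smul, Matrix.mul_one]
    ext a j
    have h1 := congrFun ((mem_eigenspace_toLin'_iff Φ lam (e j)).1 (he j)) a
    simp only [Matrix.mulVec, dotProduct, Pi.smul_apply, smul_eq_mul] at h1
    simpa only [Matrix.mul_apply, Matrix.smul_apply, E, Matrix.of_apply, smul_eq_mul] using h1
  have hΦEf : Φ * Ef = Ef * (lam' • (1 : Matrix (Fin 2) (Fin 2) k)) := by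
    rw [Matrix.mul_smul, Matrix.mul_one]
    ext a j
    have hmem := frobenius_comp_mem_eigenspace hΦf (he j)
    rw [hlam] at hmem
    have h1 := congrFun ((mem_eigenspace_toLin'_iff Φ lam' _).1 hmem) a
    simp only [Matrix.mulVec, dotProduct, Pi.smul_apply, smul_eq_mul, Function.comp_apply] at h1
    simpa only [Matrix.mul_apply, Matrix.smul_apply, Ef, E, Matrix.map_apply, Matrix.of_apply,
      smul_eq_mul] using h1
  -- (iv) block identities for `G₀`
  have hRG₀ : ∀ g, R g * G₀ = G₀ * Matrix.fromBlocks (S g) 0 0 ((S g).map (frobenius k p)) := by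
    intro g
    rw [Matrix.mul_fromCols, Matrix.fromCols_mul_fromBlocks, hRE, hREf, Matrix.mul_zero,
      Matrix.mul_zero, add_zero, zero_add]
  have hΦG₀ : Φ * G₀ =
      G₀ * Matrix.fromBlocks (lam • (1 : Matrix (Fin 2) (Fin 2) k)) 0 0
        (lam' • (1 : Matrix (Fin 2) (Fin 2) k)) := by
    rw [Matrix.mul_fromCols, Matrix.fromCols_mul_fromBlocks, hΦE, hΦEf, Matrix.mul_zero,
      Matrix.mul_zero, add_zero, zero_add]
  -- (v) transport to `G` along `finSumFinEquiv`
  have hsub : ∀ (M : Matrix (Fin 4) (Fin 4) k) (D : Matrix (Fin 2 ⊕ Fin 2) (Fin 2 ⊕ Fin 2) k),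
      M * G₀ = G₀ * D → M * G = G * Matrix.reindex finSumFinEquiv finSumFinEquiv D := by
    intro M D hMD
    have h1 : (M * G₀).submatrix id e4.symm = (G₀ * D).submatrix id e4.symm := by rw [hMD]
    rw [Matrix.submatrix_mul _ _ id id _ Function.bijective_id, Matrix.submatrix_id_id,
      Matrix.submatrix_mul _ _ id e4.symm _ e4.symm.bijective] at h1
    rw [Matrix.reindex_apply]
    exact h1
  -- (vi) `G` is invertible: its columns `e₀, e₁, F e₀, F e₁` form a basis of `k⁴`
  have hunit : IsUnit G := by
    rw [← Matrix.linearIndependent_cols_iff_isUnit]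
    have hcol : G.col = (Sum.elim e fun j => frobenius k p ∘ e j) ∘ e4.symm := by
      funext j
      change G.col j = Sum.elim e (fun j => frobenius k p ∘ e j) (e4.symm j)
      rcases hx : e4.symm j with i | i
      · funext a
        simp [G, G₀, E, Matrix.col, hx]
      · funext a
        simp [G, G₀, E, Ef, Matrix.col, hx]
    rw [hcol, linearIndependent_equiv]
    refine LinearIndependent.sum_type hli (linearIndependent_frobenius_comp hli) ?_
    refine (isCompl_eigenspace hΦ h h' hne).disjoint.mono ?_ ?_
    · exact Submodule.span_le.2 (Set.range_subset_iff.2 he)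
    · refine Submodule.span_le.2 (Set.range_subset_iff.2 fun j => ?_)
      have hmem := frobenius_comp_mem_eigenspace hΦf (he j)
      rwa [hlam] at hmem
  exact ⟨G, hunit, fun g => hsub _ _ (hRG₀ g), hsub _ _ hΦG₀⟩

end Summit.Langlands.Langlands.Theorems.PhantomRMTransport
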